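import Mathlib

/-!
# Finite-quotient obstructions for the second handle pair of four Miller–Schupp thickenings

Solo residency `solo-SmoothPoincare4-informed`, session 17; kernel certificate behind
PROPOSITION B(b) of the residency file `paper/sharpest-statement.md`, Addendum s17 (a prose
result under adjudication, not a theorem of this tree).

Context (prose, not formalised here).  For a two-generator balanced presentation
`P = ⟨x, y | r₁, r₂⟩` of the trivial group, the sequential light-bulb cancellation of the two
(2,3)-handle pairs of the traded 5-dimensional thickening `N_P`, run in the natural handle
structure with `r₂` first, needs at the second step the conjugacy `(MC₂)`: `r₁ ~ y ^ (±1)` in the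
one-relator group `⟨x, y | r₂⟩`.  For the Miller–Schupp presentations
`MS(n, w) = ⟨x, y | x⁻¹ yⁿ x y⁻⁽ⁿ⁺¹⁾, x⁻¹ w⟩` this residue group is `G_w = ⟨x, y | x = w⟩` and the
element is `m_n = x⁻¹ yⁿ x y⁻⁽ⁿ⁺¹⁾`.

What is proved here (pure group theory, kernel-checked): for the four length-14 benchmark words
`P2 = MS(2, x⁻²y⁻¹x²y⁻¹)`, `P5 = MS(2, y x² y x⁻²)`, `P3 = MS(3, y x² y)`, `P4 = MS(3, y⁻¹ x² y⁻¹)`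
(numbering of J. Carreras, arXiv:2607.23611, Table p. 4; the six presentations of A. Shehper et
al., arXiv:2408.15332, §3.3, that resisted greedy AC-search) the element `m_n` is conjugate in
`G_w` NEITHER to `y` NOR to `y⁻¹`: there is a homomorphism `ψ : G_w → S₅` with `ψ(m_n) ^ k = 1`
and `ψ(y) ^ k ≠ 1 ≠ ψ(y⁻¹) ^ k` (`k = 2` for P2, P5; `k = 3` for P3, P4).  Hence in the natural
handle structure with `x⁻¹ w` first the light-bulb scheme does not cancel the second pair of
`N_P` for these four presentations.  (For the remaining two benchmark words P1, P6 the residue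
group is `BS(2,3)` and the obstruction is Collins' lemma — prose only.)
-/

namespace Summit.SmoothPoincare4.SmoothPoincare4.Theorems
namespace SecondPairMS

open Equiv

/-! ## Generic tool: a homomorphism separating `k`-th powers obstructs conjugacy -/

/-- Powers of a conjugate. -/
theorem conj_pow_eq {G : Type*} [Group G] (c u : G) (k : ℕ) :
    (c * u * c⁻¹) ^ k = c * u ^ k * c⁻¹ := by
  induction k with
  | zero => simp
  | succ k ih => rw [pow_succ, ih, pow_succ]; group

/-- If `φ a` has `k`-th power `1` but `φ b` has not, then `a` and `b` are not conjugate. -/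
theorem not_isConj_of_pow_map {G H : Type*} [Group G] [Group H] (φ : G →* H) {a b : G}
    (k : ℕ) (ha : (φ a) ^ k = 1) (hb : (φ b) ^ k ≠ 1) : ¬ IsConj a b := by
  intro h
  obtain ⟨c, hc⟩ := isConj_iff.mp (φ.map_isConj h)
  apply hb
  rw [← hc, conj_pow_eq, ha, mul_one, mul_inv_cancel]

/-! ## One-relator residue groups and the Miller–Schupp element -/

/-- The one-relator group `⟨x, y | r⟩`. -/
abbrev OneRel (r : FreeGroup (Fin 2)) : Type := PresentedGroup ({r} : Set (FreeGroup (Fin 2)))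

/-- Generator `x`. -/
def gx (r : FreeGroup (Fin 2)) : OneRel r := PresentedGroup.of 0
/-- Generator `y`. -/
def gy (r : FreeGroup (Fin 2)) : OneRel r := PresentedGroup.of 1

/-- The Miller–Schupp element `m_n = x⁻¹ yⁿ x (yⁿ⁺¹)⁻¹` of `⟨x, y | r⟩`. -/
def msElt (r : FreeGroup (Fin 2)) (n : ℕ) : OneRel r :=
  (gx r)⁻¹ * gy r ^ n * gx r * (gy r ^ (n + 1))⁻¹

/-- Free generators. -/
def fx : FreeGroup (Fin 2) := FreeGroup.of 0
/-- Free generator `y`. -/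
def fy : FreeGroup (Fin 2) := FreeGroup.of 1

/-- The homomorphism `⟨x, y | r⟩ → S₅` determined by images satisfying the relator. -/
def psi (r : FreeGroup (Fin 2)) (img : Fin 2 → Perm (Fin 5)) (h : FreeGroup.lift img r = 1) :
    OneRel r →* Perm (Fin 5) :=
  PresentedGroup.toGroup (f := img) (by
    intro r' hr'
    rw [Set.mem_singleton_iff] at hr'
    subst hr'
    exact h)

/-- `ψ(x)` is the chosen image of `x`. -/
theorem psi_gx (r : FreeGroup (Fin 2)) (img : Fin 2 → Perm (Fin 5))
    (h : FreeGroup.lift img r = 1) : psi r img h (gx r) = img 0 := by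
  simp [psi, gx]

/-- `ψ(y)` is the chosen image of `y`. -/
theorem psi_gy (r : FreeGroup (Fin 2)) (img : Fin 2 → Perm (Fin 5))
    (h : FreeGroup.lift img r = 1) : psi r img h (gy r) = img 1 := by
  simp [psi, gy]

/-- THE CRITERION: if under some `ψ : ⟨x, y | r⟩ → S₅` the image of `m_n` has `k`-th power `1`
while the images of `y` and `y⁻¹` have not, then `m_n` is conjugate neither to `y` nor to `y⁻¹`. -/
theorem msElt_not_isConj (r : FreeGroup (Fin 2)) (img : Fin 2 → Perm (Fin 5))
    (h : FreeGroup.lift img r = 1) (n k : ℕ)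
    (h1 : ((img 0)⁻¹ * img 1 ^ n * img 0 * (img 1 ^ (n + 1))⁻¹) ^ k = 1)
    (h2 : img 1 ^ k ≠ 1) (h3 : (img 1)⁻¹ ^ k ≠ 1) :
    ¬ IsConj (msElt r n) (gy r) ∧ ¬ IsConj (msElt r n) (gy r)⁻¹ := by
  have e : psi r img h (msElt r n) = (img 0)⁻¹ * img 1 ^ n * img 0 * (img 1 ^ (n + 1))⁻¹ := by
    simp only [msElt, map_mul, map_inv, map_pow, psi_gx, psi_gy]
  refine ⟨not_isConj_of_pow_map (psi r img h) k (by rw [e]; exact h1) (by rw [psi_gy]; exact h2),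
    not_isConj_of_pow_map (psi r img h) k (by rw [e]; exact h1) ?_⟩
  rw [map_inv, psi_gy]; exact h3

/-! ## P2 = MS(2, x⁻² y⁻¹ x² y⁻¹): relator `x⁻¹ · x⁻² y⁻¹ x² y⁻¹` -/

/-- Relator of the residue group of P2. -/
def relP2 : FreeGroup (Fin 2) := fx⁻¹ * (fx⁻¹ * fx⁻¹ * fy⁻¹ * fx * fx * fy⁻¹)
/-- Images `x ↦ (0 2 1 3 4 ↦ 2 3 1 4 0)`, `y ↦ (↦ 1 0 3 4 2)` (one-line notation) for P2. -/
def imgP2 : Fin 2 → Perm (Fin 5) :=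
  ![⟨![2, 3, 1, 4, 0], ![4, 2, 0, 1, 3], by decide, by decide⟩,
    ⟨![1, 0, 3, 4, 2], ![1, 0, 4, 2, 3], by decide, by decide⟩]

/-- The images for P2 satisfy the relator. -/
theorem lift_relP2 : FreeGroup.lift imgP2 relP2 = 1 := by
  simp only [relP2, fx, fy, map_mul, map_inv, FreeGroup.lift_apply_of]
  decide

/-- MAIN STATEMENT (P2): in `⟨x, y | x = x⁻² y⁻¹ x² y⁻¹⟩` the element `x⁻¹ y² x y⁻³` is conjugate
neither to `y` nor to `y⁻¹` (witness: an `S₅`-quotient where it has order `2` and `y` order `6`). -/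
theorem msP2_not_isConj :
    ¬ IsConj (msElt relP2 2) (gy relP2) ∧ ¬ IsConj (msElt relP2 2) (gy relP2)⁻¹ :=
  msElt_not_isConj relP2 imgP2 lift_relP2 2 2 (by decide) (by decide) (by decide)

/-! ## P5 = MS(2, y x² y x⁻²): relator `x⁻¹ · y x² y x⁻²` -/

/-- Relator of the residue group of P5. -/
def relP5 : FreeGroup (Fin 2) := fx⁻¹ * (fy * fx * fx * fy * fx⁻¹ * fx⁻¹)
/-- Images for P5. -/
def imgP5 : Fin 2 → Perm (Fin 5) :=
  ![⟨![2, 3, 4, 0, 1], ![3, 4, 0, 1, 2], by decide, by decide⟩,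
    ⟨![1, 0, 3, 4, 2], ![1, 0, 4, 2, 3], by decide, by decide⟩]

/-- The images for P5 satisfy the relator. -/
theorem lift_relP5 : FreeGroup.lift imgP5 relP5 = 1 := by
  simp only [relP5, fx, fy, map_mul, map_inv, FreeGroup.lift_apply_of]
  decide

/-- MAIN STATEMENT (P5): in `⟨x, y | x = y x² y x⁻²⟩` the element `x⁻¹ y² x y⁻³` is conjugate
neither to `y` nor to `y⁻¹`. -/
theorem msP5_not_isConj :
    ¬ IsConj (msElt relP5 2) (gy relP5) ∧ ¬ IsConj (msElt relP5 2) (gy relP5)⁻¹ :=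
  msElt_not_isConj relP5 imgP5 lift_relP5 2 2 (by decide) (by decide) (by decide)

/-! ## P3 = MS(3, y x² y): relator `x⁻¹ · y x² y` -/

/-- Relator of the residue group of P3. -/
def relP3 : FreeGroup (Fin 2) := fx⁻¹ * (fy * fx * fx * fy)
/-- Images for P3. -/
def imgP3 : Fin 2 → Perm (Fin 5) :=
  ![⟨![0, 2, 4, 3, 1], ![0, 4, 1, 3, 2], by decide, by decide⟩,
    ⟨![1, 2, 3, 4, 0], ![4, 0, 1, 2, 3], by decide, by decide⟩]

/-- The images for P3 satisfy the relator. -/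
theorem lift_relP3 : FreeGroup.lift imgP3 relP3 = 1 := by
  simp only [relP3, fx, fy, map_mul, map_inv, FreeGroup.lift_apply_of]
  decide

/-- MAIN STATEMENT (P3): in `⟨x, y | x = y x² y⟩` the element `x⁻¹ y³ x y⁻⁴` is conjugate neither
to `y` nor to `y⁻¹` (witness: an `S₅`-quotient where it has order `3` and `y` order `5`). -/
theorem msP3_not_isConj :
    ¬ IsConj (msElt relP3 3) (gy relP3) ∧ ¬ IsConj (msElt relP3 3) (gy relP3)⁻¹ :=
  msElt_not_isConj relP3 imgP3 lift_relP3 3 3 (by decide) (by decide) (by decide)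

/-! ## P4 = MS(3, y⁻¹ x² y⁻¹): relator `x⁻¹ · y⁻¹ x² y⁻¹` -/

/-- Relator of the residue group of P4. -/
def relP4 : FreeGroup (Fin 2) := fx⁻¹ * (fy⁻¹ * fx * fx * fy⁻¹)
/-- Images for P4. -/
def imgP4 : Fin 2 → Perm (Fin 5) :=
  ![⟨![0, 4, 1, 3, 2], ![0, 2, 4, 3, 1], by decide, by decide⟩,
    ⟨![1, 2, 3, 4, 0], ![4, 0, 1, 2, 3], by decide, by decide⟩]

/-- The images for P4 satisfy the relator. -/
theorem lift_relP4 : FreeGroup.lift imgP4 relP4 = 1 := by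
  simp only [relP4, fx, fy, map_mul, map_inv, FreeGroup.lift_apply_of]
  decide

/-- MAIN STATEMENT (P4): in `⟨x, y | x = y⁻¹ x² y⁻¹⟩` the element `x⁻¹ y³ x y⁻⁴` is conjugate
neither to `y` nor to `y⁻¹`. -/
theorem msP4_not_isConj :
    ¬ IsConj (msElt relP4 3) (gy relP4) ∧ ¬ IsConj (msElt relP4 3) (gy relP4)⁻¹ :=
  msElt_not_isConj relP4 imgP4 lift_relP4 3 3 (by decide) (by decide) (by decide)

end SecondPairMS
end Summit.SmoothPoincare4.SmoothPoincare4.Theorems
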